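import Summits.ResolutionOfSingularities.ResolutionOfSingularities.Theorems.HomologicalConductorNoZenoRPowersContracted
import Summits.ResolutionOfSingularities.ResolutionOfSingularities.Theorems.HomologicalConductorNoZenoRGlobalGeneratorsH1
import Summits.ResolutionOfSingularities.ResolutionOfSingularities.Theorems.HomologicalConductorNoZenoRKoszulSyzygies
import Literature.AlgebraicGeometry.Motives.CartierDivisorCocycle
import Literature.AlgebraicGeometry.Resolution.Lipman1969RegularBaseChangeHolds
import HarnessLib

/-!
# Crux `NoZenoR` (stmt-ResolutionOfSingularities-19943) — the dictionary between STALKWISE contractedness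
# (`r ∈ I·𝒪_{X,x}` for all `x`) and GLOBAL SECTIONS of the ideal sheaf `I𝒪_X` (`Γ(X, I𝒪_X)`, tree `idealMul`)

Route `ResolutionOfSingularities/HomologicalConductor` (cell decomp-res, hand leafhand-res-homologicalconduct-22 g0).
OURS: AI-written, weaker than expert review; nothing here is a statement of the manuscript under review (Hironaka 2017).
SUPPORT level, counted 0.  Def-free, fact-free.

The residual named fact `Lipman1969_7_2` (Theorem (7.2): contracted products; door `…Lipman81Of72`) and the helper
`…PowersContracted` spell «`I` is contracted for `π : X → Spec S`» STALKWISE (`ExcCount.toStalk π x r ∈ I·𝒪_{X,x}` for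
all `x`), while the tree's Čech kit, which is the natural tool for Lemma (7.3) (`Γ(𝔪𝒪_X) ⊗ Γ(𝔪ⁿ𝒪_X) ↠ Γ(𝔪ⁿ⁺¹𝒪_X)`
from `H¹ = 0`; cf. `…NoZenoRGlobalGeneratorsH1.subsingleton_cechMH1_idealMul_span`), speaks of global sections of the
module sheaf `I𝒪_X = idealMul (unitModule X) (ofIdealTop (I·Γ(X, 𝒪_X)))` (`Literature/AlgebraicGeometry/Modules/IdealMul`).
This file PROVES the dictionary between the two (Görtz–Wedhorn Prop. 7.14-style sheaf bookkeeping):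

* `germ_mem_stalkIdeal_of_isIdealMulSection` / `isIdealMulSection_of_forall_germ_mem_stalkIdeal` /
  `isIdealMulSection_unit_top_iff` — for any scheme `X`, ideal sheaf `J` and global function `s`: `s` is a section of
  `J·𝒪_X` over `X` (`IsIdealMulSection (unitModule X) J ⊤ s`) iff its germ lies in the stalk `J_x` (`stalkIdeal J x`)
  at every point (the non-trivial direction: `s_x ∈ J(U)·𝒪_{X,x}` on an affine `U ∋ x` gives `g ∉ 𝔭_x` with
  `g·s ∈ J(U)` up to a unit, so `s|_{D(h)} ∈ J(D(h))`);
* `forall_toStalk_mem_iff_isIdealMulSection` — for `π : X → Spec S` and `I ⊆ S`: `r ∈ I·𝒪_{X,x}` for all `x` iff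
  `algebraMapΓ π r ∈ Γ(X, 𝒪_X)` is a section of `I𝒪_X = ofIdealTop (I·Γ(X, 𝒪_X))`, iff it is in the image of
  `Γ(X, I𝒪_X) → Γ(X, 𝒪_X)` (`exists_idealMulι_app_eq_iff`);
* `contracted_iff_range_idealMulι` — hence «`I` contracted for `π`» iff every `r ∈ S` with `algebraMapΓ π r` in the
  image of `Γ(X, I𝒪_X)` lies in `I`.

No crux, kill test or summit statement is proved here; resolution in positive characteristic is NOT proved.

References: U. Görtz, T. Wedhorn, *Algebraic Geometry I* (2020), Prop. 7.14 [`GortzWedhorn2020`]; J. Lipman, Publ.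
Math. IHÉS 36 (1969), Definition (6.1) (p. 207–208), Theorem (7.2), Lemma (7.3) (pp. 209–211) [`Lipman1969`].
-/

noncomputable section

-- single-problem summit: the doubled namespace component `ResolutionOfSingularities` is forced
set_option linter.dupNamespace false
-- `TopCat.Presheaf`/`Scheme.Modules` are not reducible (as in Mathlib's `AlgebraicGeometry/Modules`).
set_option backward.isDefEq.respectTransparency false

open CategoryTheory AlgebraicGeometry TopologicalSpace Opposite IsLocalRing
open Literature.AlgebraicGeometry.Morphisms Literature.AlgebraicGeometry.Modules
open Literature.AlgebraicGeometry.Resolution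

namespace Summit.ResolutionOfSingularities.ResolutionOfSingularities.Theorems.NoZeno.QuadraticTransform

universe u

section General

variable {X : Scheme.{u}} (J : X.IdealSheafData)

/-- **Sections of `J·𝒪_X` have germs in the stalks `J_x`.** [cite: GortzWedhorn2020, Prop. 7.14] -/
theorem germ_mem_stalkIdeal_of_isIdealMulSection {s : Γ(X, ⊤)}
    (hs : IsIdealMulSection (unitModule X) J ⊤ (show Γ(unitModule X, ⊤) from s)) (x : X) :
    (X.presheaf.germ ⊤ x trivial).hom s ∈ stalkIdeal J x := by
  obtain ⟨V, hV, hxV, hmem⟩ := hs x trivial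
  rw [mem_ideal_smul_top_unitModule_iff] at hmem
  change X.presheaf.map (homOfLE hV).op s ∈ J.ideal V at hmem
  rw [stalkIdeal_eq_map_germ J V hxV]
  have hgerm : (X.presheaf.germ ⊤ x trivial).hom s =
      (X.presheaf.germ V x hxV).hom (X.presheaf.map (homOfLE hV).op s) := by
    rw [← CommRingCat.comp_apply, TopCat.Presheaf.germ_res X.presheaf (homOfLE hV) x hxV]
  rw [hgerm]
  exact Ideal.mem_map_of_mem _ hmem

/-- **A global function whose germs lie in the stalks `J_x` is a section of `J·𝒪_X`**: on an affine `U ∋ x`,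
`s_x ∈ J(U)·𝒪_{X,x}` with `𝒪_{X,x} = Γ(U)_{𝔭_x}` gives `g, g' ∉ 𝔭_x` and `j ∈ J(U)` with `s g g' = j g'`, so on the basic
open `D(g g') ∋ x` the restriction of `s` is a unit multiple of a section of `J`. [cite: GortzWedhorn2020, Prop. 7.14] -/
theorem isIdealMulSection_of_forall_germ_mem_stalkIdeal {s : Γ(X, ⊤)}
    (hs : ∀ x : X, (X.presheaf.germ ⊤ x trivial).hom s ∈ stalkIdeal J x) :
    IsIdealMulSection (unitModule X) J ⊤ (show Γ(unitModule X, ⊤) from s) := by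
  intro x _
  obtain ⟨U, hU, hxU, -⟩ := exists_isAffineOpen_mem_and_subset (X := X) (x := x) (U := ⊤) (Opens.mem_top x)
  -- `𝒪_{X,x}` is the localization of `Γ(U)` at `𝔭 = primeIdealOf x`
  letI := X.presheaf.algebra_section_stalk (⟨x, hxU⟩ : U)
  haveI := hU.isLocalization_stalk ⟨x, hxU⟩
  set 𝔭 := (hU.primeIdealOf ⟨x, hxU⟩).asIdeal with h𝔭
  set sU : Γ(X, U) := X.presheaf.map (homOfLE (le_top : U ≤ ⊤)).op s with hsU
  have hgerm : (X.presheaf.germ ⊤ x trivial).hom s = algebraMap Γ(X, U) (X.presheaf.stalk x) sU := by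
    change (X.presheaf.germ ⊤ x trivial).hom s = (X.presheaf.germ U x hxU).hom sU
    rw [hsU, ← CommRingCat.comp_apply, TopCat.Presheaf.germ_res X.presheaf (homOfLE (le_top : U ≤ ⊤)) x hxU]
  have hmem : algebraMap Γ(X, U) (X.presheaf.stalk x) sU ∈ (J.ideal ⟨U, hU⟩).map
      (algebraMap Γ(X, U) (X.presheaf.stalk x)) := by
    have h := hs x
    rw [stalkIdeal_eq_map_germ J ⟨U, hU⟩ hxU, hgerm] at h
    exact h
  obtain ⟨⟨⟨j, hj⟩, ⟨g, hg⟩⟩, hjg⟩ := (IsLocalization.mem_map_algebraMap_iff 𝔭.primeCompl (X.presheaf.stalk x)).mp hmem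
  -- `sU * g - j ↦ 0`, so `g' * (sU * g - j) = 0` for some `g' ∉ 𝔭`
  have hzero : algebraMap Γ(X, U) (X.presheaf.stalk x) (sU * g - j) = 0 := by
    rw [map_sub, map_mul, sub_eq_zero]
    exact hjg
  obtain ⟨⟨g', hg'⟩, hg'eq⟩ := (IsLocalization.map_eq_zero_iff 𝔭.primeCompl (X.presheaf.stalk x) _).mp hzero
  -- the basic open `D(h)`, `h = g g'`, contains `x`
  set h := g * g' with hh
  have hh𝔭 : h ∈ 𝔭.primeCompl := Submonoid.mul_mem _ hg hg'
  have hxh : x ∈ X.basicOpen h := by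
    rw [X.mem_basicOpen h x hxU]
    have hu := IsLocalization.map_units (X.presheaf.stalk x) (⟨h, hh𝔭⟩ : 𝔭.primeCompl)
    exact hu
  -- on `D(h)`: `s|_{D(h)} · h| = (j g')|`, and `h|` is a unit
  have hsh : sU * h = j * g' := by
    have e : (g' : Γ(X, U)) * (sU * g - j) = 0 := hg'eq
    rw [hh]
    linear_combination e
  let D : X.affineOpens := X.affineBasicOpen (U := ⟨U, hU⟩) h
  have hDU : (D : X.Opens) ≤ U := X.basicOpen_le h
  refine ⟨D, le_top, hxh, ?_⟩
  rw [mem_ideal_smul_top_unitModule_iff]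
  change X.presheaf.map (homOfLE (le_top : (D : X.Opens) ≤ ⊤)).op s ∈ J.ideal D
  have hres : X.presheaf.map (homOfLE (le_top : (D : X.Opens) ≤ ⊤)).op s =
      X.presheaf.map (homOfLE hDU).op sU := by
    rw [hsU, Literature.AlgebraicGeometry.Motives.RatFn.res_res]
  rw [hres]
  -- `J(D(h)) ⊇ J(U)|_{D(h)}`
  have hJD : (J.ideal ⟨U, hU⟩).map (X.presheaf.map (homOfLE hDU).op).hom = J.ideal D :=
    J.map_ideal_basicOpen ⟨U, hU⟩ h
  have hunit : IsUnit (X.presheaf.map (homOfLE hDU).op h) := X.toRingedSpace.isUnit_res_basicOpen h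
  obtain ⟨v, hv⟩ := hunit
  have hprod : X.presheaf.map (homOfLE hDU).op sU * X.presheaf.map (homOfLE hDU).op h ∈ J.ideal D := by
    rw [← map_mul, hsh, map_mul, ← hJD]
    exact Ideal.mul_mem_right _ _ (Ideal.mem_map_of_mem _ hj)
  have hfinal : X.presheaf.map (homOfLE hDU).op sU =
      X.presheaf.map (homOfLE hDU).op sU * X.presheaf.map (homOfLE hDU).op h * ↑v⁻¹ := by
    rw [← hv, mul_assoc, Units.mul_inv, mul_one]
  rw [hfinal]
  exact Ideal.mul_mem_right _ _ hprod

/-- **A global function is a section of `J·𝒪_X` iff its germs lie in the stalks `J_x`.** [cite: GortzWedhorn2020, Prop. 7.14] -/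
theorem isIdealMulSection_unit_top_iff (s : Γ(X, ⊤)) :
    IsIdealMulSection (unitModule X) J ⊤ (show Γ(unitModule X, ⊤) from s) ↔
      ∀ x : X, (X.presheaf.germ ⊤ x trivial).hom s ∈ stalkIdeal J x :=
  ⟨fun hs x => germ_mem_stalkIdeal_of_isIdealMulSection J hs x,
    isIdealMulSection_of_forall_germ_mem_stalkIdeal J⟩

/-- **… iff it lies in the image of `Γ(X, J·𝒪_X) → Γ(X, 𝒪_X)`.** [cite: GortzWedhorn2020, Prop. 7.14] -/
theorem exists_idealMulι_app_eq_iff (s : Γ(X, ⊤)) :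
    (∃ m : Γ(idealMul (unitModule X) J, ⊤), (idealMulι (unitModule X) J).app ⊤ m = (show Γ(unitModule X, ⊤) from s)) ↔
      ∀ x : X, (X.presheaf.germ ⊤ x trivial).hom s ∈ stalkIdeal J x := by
  rw [← isIdealMulSection_unit_top_iff]
  constructor
  · rintro ⟨m, hm⟩
    rw [← hm]
    exact isIdealMulSection_idealMulι_app (unitModule X) J ⊤ m
  · exact exists_idealMulι_app_eq (unitModule X) J _

end General

section Contracted

variable {S : Type} [CommRing S] {X : Scheme.{0}} (π : X ⟶ Spec (.of S))

/-- **Stalkwise membership `r ∈ I·𝒪_{X,x}` for all `x` iff `algebraMapΓ π r` is a global section of `I𝒪_X`**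
(`I𝒪_X = idealMul 𝒪_X (ofIdealTop (I·Γ(X, 𝒪_X)))`, the base ideal sheaf of `…NoZenoBaseIdealCartier`), iff it lies in
the image of `Γ(X, I𝒪_X) → Γ(X, 𝒪_X)`. [cite: GortzWedhorn2020, Prop. 7.14] -/
theorem forall_toStalk_mem_iff_exists_idealMulι_app_eq (I : Ideal S) (r : S) :
    (∀ x : X, ExcCount.toStalk π x r ∈ I.map (ExcCount.toStalk π x)) ↔
      ∃ m : Γ(idealMul (unitModule X) (Scheme.IdealSheafData.ofIdealTop (I.map (algebraMapΓ π))), ⊤),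
        (idealMulι (unitModule X) (Scheme.IdealSheafData.ofIdealTop (I.map (algebraMapΓ π)))).app ⊤ m =
          (show Γ(unitModule X, ⊤) from algebraMapΓ π r) := by
  rw [exists_idealMulι_app_eq_iff]
  refine forall_congr' fun x => ?_
  rw [ExcCount.stalkIdeal_baseIdeal_eq_map_toStalk]
  rfl

/-- **«`I` is contracted for `π`» (stalkwise, as in `Lipman1969_7_2` / `…PowersContracted`) iff every `r ∈ S` whose
image `algebraMapΓ π r ∈ Γ(X, 𝒪_X)` comes from `Γ(X, I𝒪_X)` lies in `I`** — the form in which the tree's Čech kit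
(surjectivity of maps on global sections from `H¹ = 0`) applies. [cite: Lipman1969, Definition (6.1) (p. 207–208)] -/
theorem contracted_iff_forall_exists_idealMulι (I : Ideal S) :
    (∀ r : S, (∀ x : X, ExcCount.toStalk π x r ∈ I.map (ExcCount.toStalk π x)) → r ∈ I) ↔
      ∀ r : S, (∃ m : Γ(idealMul (unitModule X) (Scheme.IdealSheafData.ofIdealTop (I.map (algebraMapΓ π))), ⊤),
        (idealMulι (unitModule X) (Scheme.IdealSheafData.ofIdealTop (I.map (algebraMapΓ π)))).app ⊤ m =
          (show Γ(unitModule X, ⊤) from algebraMapΓ π r)) → r ∈ I := by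
  refine forall_congr' fun r => ?_
  rw [forall_toStalk_mem_iff_exists_idealMulι_app_eq]

/-! ### The exact residual of Prop. (8.1) in both spellings (appended) -/

/-- **Prop. (8.1) for non-regular `S` from the MINIMAL residual, stalkwise spelling**: if on ONE desingularization
`π : X → Spec S` every power `𝔪ⁿ` is contracted (`r ∈ 𝔪ⁿ·𝒪_{X,x}` for all `x` ⇒ `r ∈ 𝔪ⁿ`), then every local ring of
`Bl_𝔪(Spec S)` is an integrally closed domain (`…PowersContracted` §1 + Lemma (5.2)).  This — not the full Theorem (7.2) —
is what remains to prove for the print `Lipman1969_8_1` (regular `S`: `…Lipman81Of72`, fact-free).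
[cite: Lipman1969, Proposition (8.1) (p. 212); Theorem (7.2) (p. 209)] -/
theorem isIntegrallyClosed_stalk_affineBlowup_of_forall_pow_contracted [IsNoetherianRing S] [IsLocalRing S] [IsDomain S]
    [IsIntegrallyClosed S] (hdim : ringKrullDim S = 2) (hrat : HasRationalSingularity S) (hsing : ¬ IsRegularLocalRing S)
    (hπ : IsResolution π)
    (hcontr : ∀ (n : ℕ) (r : S),
      (∀ x : X, ExcCount.toStalk π x r ∈ (maximalIdeal S ^ n).map (ExcCount.toStalk π x)) → r ∈ maximalIdeal S ^ n)
    (y : affineBlowup (maximalIdeal S)) : IsIntegrallyClosed ((affineBlowup (maximalIdeal S)).presheaf.stalk y) :=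
  affineBlowup.isIntegrallyClosed_stalk_of_forall_pow (maximalIdeal S)
    (fun n r hr => hcontr n r fun x => toStalk_mem_map_pow_maximalIdeal_of_integralDependence π hdim hrat hsing hπ n hr x) y

/-- **The same residual in the GLOBAL-SECTIONS spelling** (the form the Čech kit produces): if for every `n` every
`r ∈ S` whose image `algebraMapΓ π r` comes from `Γ(X, 𝔪ⁿ𝒪_X)` (`idealMul 𝒪_X (ofIdealTop (𝔪ⁿ·Γ(X, 𝒪_X)))`) lies in
`𝔪ⁿ`, then `Bl_𝔪(Spec S)` is normal. [cite: Lipman1969, Proposition (8.1) (p. 212); Theorem (7.2) (p. 209)] -/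
theorem isIntegrallyClosed_stalk_affineBlowup_of_forall_pow_sections [IsNoetherianRing S] [IsLocalRing S] [IsDomain S]
    [IsIntegrallyClosed S] (hdim : ringKrullDim S = 2) (hrat : HasRationalSingularity S) (hsing : ¬ IsRegularLocalRing S)
    (hπ : IsResolution π)
    (hsec : ∀ (n : ℕ) (r : S),
      (∃ m : Γ(idealMul (unitModule X) (Scheme.IdealSheafData.ofIdealTop ((maximalIdeal S ^ n).map (algebraMapΓ π))), ⊤),
        (idealMulι (unitModule X) (Scheme.IdealSheafData.ofIdealTop ((maximalIdeal S ^ n).map (algebraMapΓ π)))).app ⊤ m =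
          (show Γ(unitModule X, ⊤) from algebraMapΓ π r)) → r ∈ maximalIdeal S ^ n)
    (y : affineBlowup (maximalIdeal S)) : IsIntegrallyClosed ((affineBlowup (maximalIdeal S)).presheaf.stalk y) :=
  isIntegrallyClosed_stalk_affineBlowup_of_forall_pow_contracted π hdim hrat hsing hπ
    (fun n => (contracted_iff_forall_exists_idealMulι π (maximalIdeal S ^ n)).mpr (hsec n)) y

/-! ### Chart data for road (R1′): the affine-open ideals of the base ideal sheaves `Iⁿ𝒪_X`, `(IJ)𝒪_X` (appended) -/

/-- On an affine open `V`, the ideal of `(I·J)𝒪_X` is the product of those of `I𝒪_X` and `J𝒪_X`. [folklore] -/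
theorem ofIdealTop_map_mul_ideal (I J : Ideal S) (V : X.affineOpens) :
    (Scheme.IdealSheafData.ofIdealTop ((I * J).map (algebraMapΓ π))).ideal V =
      (Scheme.IdealSheafData.ofIdealTop (I.map (algebraMapΓ π))).ideal V *
        (Scheme.IdealSheafData.ofIdealTop (J.map (algebraMapΓ π))).ideal V := by
  simp only [Scheme.IdealSheafData.ofIdealTop_ideal, Ideal.map_mul]

/-- On an affine open `V`, the ideal of `Iⁿ𝒪_X` is the `n`-th power of that of `I𝒪_X`. [folklore] -/
theorem ofIdealTop_map_pow_ideal (I : Ideal S) (n : ℕ) (V : X.affineOpens) :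
    (Scheme.IdealSheafData.ofIdealTop ((I ^ n).map (algebraMapΓ π))).ideal V =
      (Scheme.IdealSheafData.ofIdealTop (I.map (algebraMapΓ π))).ideal V ^ n := by
  simp only [Scheme.IdealSheafData.ofIdealTop_ideal, Ideal.map_pow]

/-- On an affine open `V`, the ideal of `(t₁,…,t_s)𝒪_X` is generated by the restrictions of the `tᵢ`. [folklore] -/
theorem ofIdealTop_map_span_range_ideal {s : ℕ} (t : Fin s → S) (V : X.affineOpens) :
    (Scheme.IdealSheafData.ofIdealTop ((Ideal.span (Set.range t)).map (algebraMapΓ π))).ideal V =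
      Ideal.span (Set.range fun i =>
        X.presheaf.map (homOfLE (le_top : (V : X.Opens) ≤ ⊤)).op (algebraMapΓ π (t i))) := by
  rw [Scheme.IdealSheafData.ofIdealTop_ideal, Ideal.map_span, Ideal.map_span, ← Set.range_comp, ← Set.range_comp]
  rfl

/-- **Chart data on an affine open where `𝔪𝒪_X` is principal**: if `(t₁,…,t_s) = 𝔪` and the ideal of `𝔪𝒪_X` on the
affine open `V` is `(g)` with `g` a non-zero-divisor, then the ideal of `𝔪ⁿ𝒪_X` on `V` is `(gⁿ)`, and the restrictions
`tᵢ|_V = g·vᵢ` with `(vᵢ)` unimodular — the hypotheses of `…KoszulSyzygies.mem_span_monomial_koszul`. [folklore] -/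
theorem chart_data_of_ideal_eq_span_singleton {s : ℕ} (t : Fin s → S) (V : X.affineOpens)
    {g : Γ(X, V)} (hg : g ∈ nonZeroDivisors Γ(X, V))
    (hV : (Scheme.IdealSheafData.ofIdealTop ((Ideal.span (Set.range t)).map (algebraMapΓ π))).ideal V =
      Ideal.span {g}) (n : ℕ) :
    (Scheme.IdealSheafData.ofIdealTop ((Ideal.span (Set.range t) ^ n).map (algebraMapΓ π))).ideal V =
        Ideal.span {g ^ n} ∧
      ∃ v w : Fin s → Γ(X, V),
        (∀ i, X.presheaf.map (homOfLE (le_top : (V : X.Opens) ≤ ⊤)).op (algebraMapΓ π (t i)) = g * v i) ∧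
        ∑ i, w i * v i = 1 := by
  refine ⟨by rw [ofIdealTop_map_pow_ideal, hV, Ideal.span_singleton_pow], ?_⟩
  rw [ofIdealTop_map_span_range_ideal] at hV
  exact exists_unimodular_of_span_range_eq_span_singleton g hg _ hV

/-! ### Reduction of the contractedness step to Γ-GENERATION (appended):
`Γ(X, 𝔪ⁿ⁺¹𝒪_X) = Σ tᵢ·Γ(X, 𝔪ⁿ𝒪_X)` and `𝔪ⁿ` contracted ⇒ `𝔪ⁿ⁺¹` contracted -/

/-- **The induction step of «all powers of `𝔪` are contracted», reduced to Γ-generation** (Lipman, Cor. of Lemma (7.3),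
`Γ(𝓘)·Γ(𝓙) = Γ(𝓘𝓙)`, for `𝓘 = 𝔪𝒪_X`, `𝓙 = 𝔪ⁿ𝒪_X`): on a desingularization `π : X → Spec S` of the normal domain `S`
with `𝔪 = (t₁,…,t_s)`, if `𝔪ⁿ` is contracted and every global section of `𝔪ⁿ⁺¹𝒪_X` is `Σ tᵢ · (global section of 𝔪ⁿ𝒪_X)`,
then `𝔪ⁿ⁺¹` is contracted — because `Γ(X, 𝒪_X) = S` (`algebraMapΓ` is bijective for a resolution of a normal domain).
[cite: Lipman1969, Lemma (7.3) Corollary and Theorem (7.2) (pp. 210–211)] -/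
theorem pow_succ_contracted_of_sections_generate [IsNoetherianRing S] [IsDomain S] [IsIntegrallyClosed S] [IsLocalRing S]
    (hπ : IsResolution π) {s : ℕ} (t : Fin s → S) (ht : ∀ i, t i ∈ maximalIdeal S) (n : ℕ)
    (hn : ∀ r : S, (∀ x : X, ExcCount.toStalk π x r ∈ (maximalIdeal S ^ n).map (ExcCount.toStalk π x)) →
      r ∈ maximalIdeal S ^ n)
    (hgen : ∀ y : Γ(idealMul (unitModule X) (Scheme.IdealSheafData.ofIdealTop ((maximalIdeal S ^ (n + 1)).map (algebraMapΓ π))), ⊤),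
      ∃ m : Fin s → Γ(idealMul (unitModule X) (Scheme.IdealSheafData.ofIdealTop ((maximalIdeal S ^ n).map (algebraMapΓ π))), ⊤),
        (show Γ(X, ⊤) from (idealMulι (unitModule X) _).app ⊤ y) =
          ∑ i, algebraMapΓ π (t i) * (show Γ(X, ⊤) from (idealMulι (unitModule X) _).app ⊤ (m i)))
    (r : S) (hr : ∀ x : X, ExcCount.toStalk π x r ∈ (maximalIdeal S ^ (n + 1)).map (ExcCount.toStalk π x)) :
    r ∈ maximalIdeal S ^ (n + 1) := by
  classical
  -- `algebraMapΓ π r` is a global section of `𝔪ⁿ⁺¹𝒪_X`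
  obtain ⟨y, hy⟩ := (forall_toStalk_mem_iff_exists_idealMulι_app_eq π (maximalIdeal S ^ (n + 1)) r).mp hr
  obtain ⟨m, hm⟩ := hgen y
  -- each `ι(mᵢ) ∈ Γ(X, 𝒪_X) = S` comes from some `aᵢ ∈ 𝔪ⁿ` (contractedness of `𝔪ⁿ`)
  have hsurj := algebraMapΓ_surjective_of_isResolution π hπ
  have ha : ∀ i, ∃ a : S, a ∈ maximalIdeal S ^ n ∧
      algebraMapΓ π a = (show Γ(X, ⊤) from (idealMulι (unitModule X) _).app ⊤ (m i)) := by
    intro i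
    obtain ⟨a, ha⟩ := hsurj (show Γ(X, ⊤) from (idealMulι (unitModule X) _).app ⊤ (m i))
    refine ⟨a, hn a ((forall_toStalk_mem_iff_exists_idealMulι_app_eq π (maximalIdeal S ^ n) a).mpr ⟨m i, ?_⟩), ha⟩
    exact ha.symm
  choose a haI haΓ using ha
  -- `r = Σ tᵢ aᵢ`
  have hinj : Function.Injective (algebraMapΓ π) := Lipman1969_16_1_ii_holds_aux.algebraMapΓ_injective_of_isBirational π hπ.isBirational
  have hreq : r = ∑ i, t i * a i := by
    apply hinj
    rw [map_sum]
    have h1 : algebraMapΓ π r = (show Γ(X, ⊤) from (idealMulι (unitModule X) _).app ⊤ y) := hy.symm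
    rw [h1, hm]
    exact Finset.sum_congr rfl fun i _ => by rw [map_mul, haΓ]
  rw [hreq, pow_succ']
  exact Ideal.sum_mem _ fun i _ => Ideal.mul_mem_mul (ht i) (haI i)

/-- **Prop. (8.1) for non-regular `S` from Γ-GENERATION on one desingularization**: if for every `n ≥ 1` every global
section of `𝔪ⁿ⁺¹𝒪_X` is `Σ tᵢ · (global section of 𝔪ⁿ𝒪_X)` (`𝔪 = (t₁,…,t_s)`), then all powers `𝔪ⁿ` are contracted
(base case `𝔪`: `mem_maximalIdeal_of_forall_toStalk_mem`), hence complete, hence `Bl_𝔪(Spec S)` is normal.  The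
Γ-generation hypothesis is what `Ȟ¹(ker((𝔪ⁿ𝒪_X)^{⊕s} → 𝔪ⁿ⁺¹𝒪_X)) = 0` delivers (road (R1′): the kernel is generated by
the global sections `t^β(t_jε_i − t_iε_j)`, `…KoszulSyzygies`, and `Ȟ¹` is right exact on resolutions of surface germs).
[cite: Lipman1969, Proposition (8.1) (p. 212); Theorem (7.2), Lemma (7.3) (pp. 209–211)] -/
theorem isIntegrallyClosed_stalk_affineBlowup_of_sections_generate [IsNoetherianRing S] [IsDomain S]
    [IsIntegrallyClosed S] [IsLocalRing S] (hdim : ringKrullDim S = 2) (hrat : HasRationalSingularity S)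
    (hsing : ¬ IsRegularLocalRing S) (hπ : IsResolution π) {s : ℕ} (t : Fin s → S) (ht : ∀ i, t i ∈ maximalIdeal S)
    (hgen : ∀ n : ℕ, 1 ≤ n →
      ∀ y : Γ(idealMul (unitModule X) (Scheme.IdealSheafData.ofIdealTop ((maximalIdeal S ^ (n + 1)).map (algebraMapΓ π))), ⊤),
      ∃ m : Fin s → Γ(idealMul (unitModule X) (Scheme.IdealSheafData.ofIdealTop ((maximalIdeal S ^ n).map (algebraMapΓ π))), ⊤),
        (show Γ(X, ⊤) from (idealMulι (unitModule X) _).app ⊤ y) =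
          ∑ i, algebraMapΓ π (t i) * (show Γ(X, ⊤) from (idealMulι (unitModule X) _).app ⊤ (m i)))
    (y : affineBlowup (maximalIdeal S)) : IsIntegrallyClosed ((affineBlowup (maximalIdeal S)).presheaf.stalk y) := by
  refine isIntegrallyClosed_stalk_affineBlowup_of_forall_pow_contracted π hdim hrat hsing hπ (fun n => ?_) y
  induction n with
  | zero => intro r _; rw [pow_zero, Ideal.one_eq_top]; exact Submodule.mem_top
  | succ n ih =>
    rcases Nat.eq_zero_or_pos n with rfl | hn
    · intro r hr
      rw [zero_add, pow_one] at hr ⊢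
      exact mem_maximalIdeal_of_forall_toStalk_mem π hπ hr
    · exact pow_succ_contracted_of_sections_generate π hπ t ht n ih (hgen n hn)

end Contracted

end Summit.ResolutionOfSingularities.ResolutionOfSingularities.Theorems.NoZeno.QuadraticTransform

end
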